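import Mathlib
import HarnessLib
import Summits.AnomalousDissipation.AnomalousDissipation.Theses.MirrorVariety

/-!
# Sketch (crux-ideate r1 gen 2, ideator 2) — crux `MirrorVariety.TaylorGreenLoudGalerkinStates`
(stmt-AnomalousDissipation-2987). First lemmas of idea card `frozen-cell-amplitude-gauge`.

The AMPLITUDE GAUGE: write a steady Taylor–Green state as `U = θ • fhat + v` with `fhat = 2 f_TG`
(unit `L²` norm, Stokes eigenfield `Δ fhat = -12π² fhat`) and `v ⊥ f_TG`; trade the fixed force
amplitude for a free viscosity by the exact scaling `(U, ν, f) ↦ (U/s, ν/s, f/s²)` and normalise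
`θ = 1`.  The steady problem becomes the FROZEN-CELL problem for the secondary flow `v`
(`FrozenCellSteady`): the tested Galerkin equations of `fhat + v` against tests orthogonal to the
force, in which NO force amplitude appears; the amplitude is recovered as `a' = ν ‖∇(fhat+v)‖²`.
Props only (no proofs at the ideate stage); every constant is an existing declaration of
`Literature.Analysis.FunctionSpaces.Torus` or Mathlib.
-/

namespace Summit.AnomalousDissipation.AnomalousDissipation.Cruxes.TaylorGreenLoudGalerkinStates.FrozenCellAmplitudeGauge

open MeasureTheory Filter
open scoped Topology
open Literature.Analysis.FunctionSpaces Literature.Analysis.FunctionSpaces.Torus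

local notation "𝕋³" => UnitAddTorus (Fin 3)
local notation "E³" => EuclideanSpace ℝ (Fin 3)

/-- The Taylor–Green force of the crux, literally as in `MirrorVariety.TaylorGreenLoudGalerkinStates`
(`‖f_TG‖_{L²}² = 1/4`, Fourier support = the 8-point shell `|k|² = 3`). -/
noncomputable def tgForce : 𝕋³ → E³ := fun x =>
  !₂[(fourier 1 (x 0) : ℂ).im * (fourier 1 (x 1) : ℂ).re * (fourier 1 (x 2) : ℂ).re,
     -((fourier 1 (x 0) : ℂ).re * (fourier 1 (x 1) : ℂ).im * (fourier 1 (x 2) : ℂ).re), (0 : ℝ)]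

/-- The unit cell `fhat = 2 f_TG` (`‖fhat‖_{L²} = 1`): the FROZEN background of the gauge. -/
noncomputable def fhat : 𝕋³ → E³ := fun x => (2 : ℝ) • tgForce x

/-- The exact first Reynolds step `b₀ = P[(fhat·∇)fhat] = π (sin4πx cos4πz, sin4πy cos4πz,
-sin4πz (cos4πx + cos4πy))` — Leray projection computed by hand (the gradient part
`(π/2)(sin4πx, sin4πy, 0)·… ` drops); a single vector on the shell `|k|² = 8`, `‖b₀‖_{L²} = π`.
(Taylor–Green 1937's first correction; in the 64-fold TG class the shell `|k|² = 8` is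
one-dimensional, so `b₀` is forced to be this field up to scale.) -/
noncomputable def tgSource : 𝕋³ → E³ := fun x =>
  Real.pi • !₂[(fourier 2 (x 0) : ℂ).im * (fourier 2 (x 2) : ℂ).re,
               (fourier 2 (x 1) : ℂ).im * (fourier 2 (x 2) : ℂ).re,
               -((fourier 2 (x 2) : ℂ).im * ((fourier 2 (x 0) : ℂ).re + (fourier 2 (x 1) : ℂ).re))]

/-- Band-limited to the punctured frequency ball of radius `N` (the crux's clause). -/
def IsBandLimited (N : ℕ) (U : 𝕋³ → E³) : Prop :=
  ∀ k ∉ (freqBall N).erase (0 : Fin 3 → ℤ),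
    UnitAddTorus.mFourierCoeff (EuclideanSpace.complexify ∘ U) k = 0

/-- The crux's tested steady Galerkin equations at resolution `N`, viscosity `ν`, force `f`
(verbatim the bracket of `TaylorGreenLoudGalerkinStates`). -/
def IsGalerkinSteady (N : ℕ) (ν : ℝ) (f U : 𝕋³ → E³) : Prop :=
  IsSmooth U ∧ IsDivFree U ∧ HasZeroMean U ∧ IsBandLimited N U ∧
  ∀ a : 𝕋³ → E³, IsSmooth a → IsDivFree a → IsBandLimited N a →
    ∫ x, (inner ℝ (U x) (convect U a x) + ν * inner ℝ (U x) (laplacian a x)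
      + inner ℝ (f x) (a x)) = 0

/-- **The frozen-cell problem (★₁).** A secondary flow `v` at `(N, ν)`: admissible, orthogonal to the
force, and `fhat + v` satisfies the tested steady equations against every admissible test `b`
ORTHOGONAL TO THE FORCE.  No force amplitude occurs (`⟪f, b⟫ = 0` and `⟪fhat, Δ b⟫ = -12π²⟪fhat, b⟫ = 0`
remove it); the equation against the one remaining test direction `fhat` only DEFINES the amplitude
`a' = ν‖∇(fhat+v)‖²` (lemma `GaugeForward`).  In words: steady Navier–Stokes for the perturbation of the
unit Taylor–Green cell, driven by the exact source `b₀ = tgSource` and strained by `fhat`. -/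
def FrozenCellSteady (N : ℕ) (ν : ℝ) (v : 𝕋³ → E³) : Prop :=
  IsSmooth v ∧ IsDivFree v ∧ HasZeroMean v ∧ IsBandLimited N v ∧
  (∫ x, inner ℝ (tgForce x) (v x)) = 0 ∧
  ∀ b : 𝕋³ → E³, IsSmooth b → IsDivFree b → IsBandLimited N b →
    (∫ x, inner ℝ (tgForce x) (b x)) = 0 →
    ∫ x, (inner ℝ (fhat x + v x) (convect (fun y => fhat y + v y) b x)
      + ν * inner ℝ (v x) (laplacian b x)) = 0

/-! ## First lemmas (all provable now; sizes S–M) -/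

/-- `b₀` IS the first Reynolds step: `∫⟪fhat, (fhat·∇) b⟫ = -∫⟪b₀, b⟫` for smooth div-free `b`
(integration by parts + the hand Leray projection above). Size M (trigonometric bookkeeping). -/
def TgSourceIsFirstReynoldsStep : Prop :=
  ∀ b : 𝕋³ → E³, IsSmooth b → IsDivFree b →
    ∫ x, inner ℝ (fhat x) (convect fhat b x) = -(∫ x, inner ℝ (tgSource x) (b x))

/-- **Gauge, backward direction.** Every steady TG Galerkin state `U` at `(N, ν)` has positive
injection `w = ∫⟪f_TG, U⟫ = ν‖∇U‖² > 0` (energy identity; `U = 0` is not steady since `f ≠ 0`), and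
`v := U/(2w) - fhat` solves the frozen-cell problem at viscosity `ν/(2w)` (`θ = ⟪fhat, U⟫ = 2w`;
homogeneity `(θ, v, ν) ↦ (1, v/θ, ν/θ)`). Size S–M. -/
def GaugeBackward : Prop :=
  ∀ (N : ℕ) (ν : ℝ) (U : 𝕋³ → E³), 0 < ν → 2 ≤ N → IsGalerkinSteady N ν tgForce U →
    0 < (∫ x, inner ℝ (tgForce x) (U x)) ∧
    FrozenCellSteady N (ν / (2 * ∫ x, inner ℝ (tgForce x) (U x)))
      (fun x => (1 / (2 * ∫ y, inner ℝ (tgForce y) (U y))) • U x - fhat x)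

/-- **Gauge, forward direction.** A frozen-cell solution `v` at `(N, ν)`, `ν > 0`, `N ≥ 2`, gives
`a' := ν‖∇(fhat + v)‖² > 0` and, after the exact rescaling by `s = √(2a')`, a steady Galerkin state for
the crux's literal force `f_TG` at viscosity `ν/√(2a')`:  `U = (fhat + v)/√(2a')`.  (The test direction
`fhat` is recovered from the `b`-equations and the energy identity: `T_{fhat}(fhat+v) = -ν‖∇v‖²`.)
Size M. -/
def GaugeForward : Prop :=
  ∀ (N : ℕ) (ν : ℝ) (v : 𝕋³ → E³), 0 < ν → 2 ≤ N → FrozenCellSteady N ν v →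
    0 < ν * gradNormSq (fun x => fhat x + v x) ∧
    IsGalerkinSteady N (ν / Real.sqrt (2 * (ν * gradNormSq (fun x => fhat x + v x)))) tgForce
      (fun x => (1 / Real.sqrt (2 * (ν * gradNormSq (fun x => fhat x + v x)))) • (fhat x + v x))

/-- **Secondary energy identity** (test (★₁) with `b := v`): the dissipation of the secondary flow
equals the work of the first Reynolds step on it plus the energy it extracts from the cell's strain,
`ν‖∇v‖² = -⟪b₀, v⟫ - ∫ vᵀ(∇fhat) v`.  Size S given `TgSourceIsFirstReynoldsStep`. -/
def SecondaryEnergyIdentity : Prop :=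
  ∀ (N : ℕ) (ν : ℝ) (v : 𝕋³ → E³), FrozenCellSteady N ν v →
    ν * gradNormSq v = -(∫ x, inner ℝ (tgSource x) (v x)) - ∫ x, inner ℝ (v x) (convect v fhat x)

/-- **Automatic loudness.** Since `‖b₀‖_{L²} = π` and the strain of the unit cell has operator norm
`≤ 4π` pointwise (`S_{fhat} = [[a,0,p],[0,-a,q],[p,q,0]]`, `a = 4π cXcYcZ`, `p,q = ∓2π …`), an `L²` bound
on the secondary flow bounds its dissipation: `ν‖∇v‖² ≤ π C + 4π C²` whenever `∫|v|² ≤ C²`.  In the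
gauge dictionary this says: BOUNDED SECONDARY FLOW ⇒ LOUD rescaled state
(`W̃ = 1/(2√(2a'))`, `a' = 12π²ν + ν‖∇v‖²`).  Size S given `SecondaryEnergyIdentity`. -/
def AutomaticLoudness : Prop :=
  ∀ (N : ℕ) (ν C : ℝ) (v : 𝕋³ → E³), 0 < ν → 0 ≤ C → FrozenCellSteady N ν v →
    ∫ x, ‖v x‖ ^ 2 ≤ C ^ 2 → ν * gradNormSq v ≤ Real.pi * C + 4 * Real.pi * C ^ 2

/-! ## The transfer target `C⁺` and its dictionary -/

/-- **C⁺ = BoundedSecondaryFlows** (the crux in the gauge; finite-`N`, inside MirrorVariety's lever).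
Along some `ν_j → 0⁺`, for every `j` and all large `N`, the frozen-cell problem has a solution that is
BOUNDED in `L²` and NOT asymptotically work-free (`ν_j‖∇v‖² ≥ c`).  Loudness is not asked — it is
automatic; bounded rescaled energy is exactly the clause `c ≤ ν_j‖∇v‖²`. -/
def BoundedSecondaryFlows : Prop :=
  ∃ (ν : ℕ → ℝ) (C c : ℝ), (∀ j, 0 < ν j) ∧ Tendsto ν atTop (𝓝 0) ∧ 0 < c ∧
    ∀ j, ∀ᶠ N in atTop, ∃ v : 𝕋³ → E³,
      FrozenCellSteady N (ν j) v ∧ ∫ x, ‖v x‖ ^ 2 ≤ C ∧ c ≤ ν j * gradNormSq v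

/-- What `C⁺` yields by pure algebra (`GaugeForward` + the two identities): loud bounded steady
Galerkin states for the LITERAL force `f_TG` at all large `N`, at viscosities inside a band
`[ν_j/κ, ν_j]` of fixed relative width `κ` (the rescaled viscosity `ν_j/√(2a')` depends on the solution
through `a' ∈ [c, 12π²ν_j + π√C + 4πC]`).  This is the crux up to the alignment of the exact viscosity
across `N` — the same nondegeneracy/index transfer every line of this crux uses (TRIAGE-r1-1 T2/T3), or
trivially the crux's PDE shadow after `N → ∞` at fixed `j` (route support `FixedViscosityTransfer` with
convergent viscosities). -/
def GaugedLoudStates : Prop :=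
  ∃ (ν : ℕ → ℝ) (E ε κ : ℝ), (∀ j, 0 < ν j) ∧ Tendsto ν atTop (𝓝 0) ∧ 0 < ε ∧ 1 ≤ κ ∧
    ∀ j, ∀ᶠ N in atTop, ∃ ν' : ℝ, ν j / κ ≤ ν' ∧ ν' ≤ ν j ∧ ∃ U : 𝕋³ → E³,
      IsGalerkinSteady N ν' tgForce U ∧ ∫ x, ‖U x‖ ^ 2 ≤ E ∧ ε ≤ ν' * gradNormSq U

/-- The dictionary as a statement (provable now from the first lemmas; size M). -/
def Dictionary : Prop := BoundedSecondaryFlows → GaugedLoudStates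

/-- Converse direction (provable now from `GaugeBackward`; size S–M): the crux's own conclusion for
`f_TG` implies `C⁺` — so `C⁺` is an honest EQUIVALENT of the crux's PDE content, not a weakening. -/
def ConverseDictionary : Prop :=
  Summit.AnomalousDissipation.AnomalousDissipation.Theses.MirrorVariety.TaylorGreenLoudGalerkinStates →
    BoundedSecondaryFlows

/-- Sanity: the crux decl is in scope by name (this sketch does not prove it). -/
example : Prop :=
  Summit.AnomalousDissipation.AnomalousDissipation.Theses.MirrorVariety.TaylorGreenLoudGalerkinStates

end Summit.AnomalousDissipation.AnomalousDissipation.Cruxes.TaylorGreenLoudGalerkinStates.FrozenCellAmplitudeGauge
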